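import Summits.AtomisticToContinuum.Crystallization.Theorems.ExcessDecayLiouvilleRelaxationNewton
import Summits.AtomisticToContinuum.Crystallization.Theorems.ExcessDecayLiouvilleConsistency
import Summits.AtomisticToContinuum.Crystallization.Theorems.ExcessDecayLiouvilleSelfForce

/-!
# Route `ExcessDecayLiouville`: the base case of the scale induction — relaxing the datum (nonlinear half, XXXIII)

Harmonic-replacement architecture for item `ExcessDecay` (stmt-AtomisticToContinuum-9334), nonlinear half.
The perfect two-lattice `(t, A)` need not be in equilibrium (a strained cell is not), but when it is `ε`-matched
with a separated Lennard-Jones equilibrium its reference force is `O(ε + r⁻⁴)` (`norm_refForce_le_of_matched`).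
Here: the displaced self-force of the ZERO approximant at `t 0` equals the reference force at any site of the
sublattice `S₀` (`selfForce_zero_eq_refForce`, `dispForce_sublattice_const`), hence is small at a matched
datum (`norm_selfForce_zero_le`), and `exists_relaxed_field` relaxes it by a sublattice shift `ξ₀` with
`‖ξ₀‖ ≤ (4/κ)·(that bound)` (`base_relaxation`) — the initial RELAXED approximant of the induction.
All `[folklore]`; helper lemmas, nothing here closes an item.
-/

noncomputable section

namespace Summit.AtomisticToContinuum.Crystallization.Theorems.ExcessDecayLiouville

open scoped BigOperators Topology InnerProductSpace RealInnerProductSpace Classical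
open Literature.MathematicalPhysics.StatisticalMechanics
open Summit.AtomisticToContinuum.Crystallization.Theorems.PhononStabilityNegative

local notation "E3" => EuclideanSpace ℝ (Fin 3)

-- Local notation: the force-constant map `K(e)w = h(|e|²)w + 2⟪e,w⟫h′(|e|²)e`.
local notation3 "𝕂[" e "] " w:max =>
  (-((‖e‖ ^ 2)⁻¹) ^ 7 + ((‖e‖ ^ 2)⁻¹) ^ 4) • w + (2 * ⟪e, w⟫ * (7 * ((‖e‖ ^ 2)⁻¹) ^ 8 - 4 * ((‖e‖ ^ 2)⁻¹) ^ 5)) • e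
-- Local notation: the pair force `F(x) = h(|x|²) x`.
local notation3 "𝐅[" x "]" => ((-((‖x‖ ^ 2)⁻¹) ^ 7 + ((‖x‖ ^ 2)⁻¹) ^ 4) • x)

section

variable {X : Set E3} {c : E3} {r ε δ κ : ℝ} {t : Fin 2 → E3} {A : E3 →L[ℝ] E3} {π : E3 → E3}

set_option quotPrecheck false in
-- Local notation: the operator row `(L v)(p)`.
local notation "𝕃" v:max " @ " p:max =>
  tsum (fun q : Sites₀ t A => (if ((p : Sites₀ t A) : E3) ≠ q then 𝕂[((p : Sites₀ t A) : E3) - q] (v ((p : Sites₀ t A) : E3) - v q) else 0))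
set_option quotPrecheck false in
-- Local notation: the displaced self-force `G(p)` of the background `aff`.
local notation "𝐆[" aff "] " p:max =>
  tsum (fun q : Sites₀ t A => (if (p : E3) ≠ q then 𝐅[((p : E3) - q) + (aff (p : E3) - aff q)] else 0))

/-- **The self-force of the zero approximant is the reference force**: at a site `s`,
`G[0](s) = Σ'_{q ∈ S, q ≠ s} (V′(|s − q|)/|s − q|)(s − q)`. [folklore] -/
theorem selfForce_zero_eq_refForce (s : Sites₀ t A) :
    𝐆[fun _ : E3 => (0 : E3)] s =
      ∑' q : {q : E3 // q ∈ Sites₀ t A ∧ q ≠ s}, (deriv lennardJones (dist (s : E3) q) / dist (s : E3) q) • ((s : E3) - (q : E3)) := by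
  -- both sides are sums of the same function over the same set of points
  have hL : 𝐆[fun _ : E3 => (0 : E3)] s = ∑' q : E3, (Sites₀ t A).indicator
      (fun q : E3 => if (s : E3) ≠ q then 𝐅[(s : E3) - q] else 0) q := by
    rw [← tsum_subtype (Sites₀ t A) (fun q : E3 => if (s : E3) ≠ q then 𝐅[(s : E3) - q] else 0)]
    refine tsum_congr fun q => ?_
    simp only [sub_zero, add_zero]
  have hR : (∑' q : {q : E3 // q ∈ Sites₀ t A ∧ q ≠ s}, (deriv lennardJones (dist (s : E3) q) / dist (s : E3) q) • ((s : E3) - (q : E3))) =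
      ∑' q : E3, ({q : E3 | q ∈ Sites₀ t A ∧ q ≠ s}).indicator
        (fun q : E3 => (deriv lennardJones (dist (s : E3) q) / dist (s : E3) q) • ((s : E3) - q)) q :=
    tsum_subtype ({q : E3 | q ∈ Sites₀ t A ∧ q ≠ s}) (fun q : E3 => (deriv lennardJones (dist (s : E3) q) / dist (s : E3) q) • ((s : E3) - q))
  rw [hL, hR]
  refine tsum_congr fun q => ?_
  by_cases hq : q ∈ Sites₀ t A
  · by_cases hqs : q = s
    · rw [Set.indicator_of_mem hq, Set.indicator_of_notMem (fun h => h.2 hqs), if_neg (fun h => h hqs.symm)]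
    · rw [Set.indicator_of_mem hq, Set.indicator_of_mem (show q ∈ {q : E3 | q ∈ Sites₀ t A ∧ q ≠ s} from ⟨hq, hqs⟩),
        if_pos (fun h => hqs h.symm), dist_eq_norm, ljForce_eq_smul (sub_ne_zero.2 (fun h => hqs h.symm))]
  · rw [Set.indicator_of_notMem hq, Set.indicator_of_notMem (fun h => hq h.1)]

/-- **The self-force of the zero approximant is small at a matched datum**: with a matching of the sites of
`B_r(c)` (`r ≥ 4`) as in `norm_refForce_le_of_matched`,
`‖G[0](t 0)‖ ≤ 2048/((23/25)³(r − 11/10)⁴) + 6000(2ε)² S + 76 ε S′ + 2048/(δ³(r − 11/10 − 2ε)⁴)`. [folklore] -/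
theorem norm_selfForce_zero_le (hA : Adm₀ A) (hI : Inner₀ t A) (hX : X.Finite)
    (hsep : ∀ p ∈ X, ∀ q ∈ X, p ≠ q → δ ≤ dist p q) (hδ : 0 < δ) (hδ1 : δ ≤ 1) (hε0 : 0 ≤ ε) (hε2 : 2 * ε < δ)
    (hε : ε ≤ 1 / 20) (hr : 4 ≤ r) (hequil : Equil₀ X)
    (hXb : ∀ p ∈ X, dist p c ≤ r → ∃ m : Fin 2, ∃ z ∈ Λ₀, dist p (t m + A z) ≤ ε)
    (hπ : ∀ s' ∈ Sites₀ t A, dist s' c ≤ r → π s' ∈ X ∧ dist (π s') s' ≤ ε)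
    (hinj : ∀ s₁ ∈ Sites₀ t A, ∀ s₂ ∈ Sites₀ t A, dist s₁ c ≤ r → dist s₂ c ≤ r → π s₁ = π s₂ → s₁ = s₂)
    (SR : Finset E3) (hSR : ∀ x, x ∈ SR ↔ x ∈ Sites₀ t A ∧ dist x c ≤ r) :
    ‖𝐆[fun _ : E3 => (0 : E3)] (⟨t 0, t0_mem_sites⟩ : Sites₀ t A)‖ ≤
      2048 / ((23 / 25 : ℝ) ^ 3 * (r - 11 / 10) ^ 4) +
        6000 * (2 * ε) ^ 2 * (1024 / ((23 / 25 : ℝ) ^ 3 * (23 / 25 : ℝ) ^ 6)) +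
        76 * ε * (1024 / ((23 / 25 : ℝ) ^ 3 * (23 / 25 : ℝ) ^ 5)) +
        2048 / (δ ^ 3 * (r - 11 / 10 - 2 * ε) ^ 4) := by
  -- a site of the sublattice S₀ near the centre
  obtain ⟨z, hz, hzd⟩ := exists_site_dist_le hA t 0 c
  have hs : t 0 + A z ∈ Sites₀ t A := add_mem_sites₀ t0_mem_sites hz
  -- the self-force is constant on the sublattice
  have haff0 : ∀ (m : Fin 2) (z : E3), z ∈ Λ₀ → (fun _ : E3 => (0 : E3)) (t m + A z) =
      (0 : Fin 2 → E3) m + (0 : E3 →L[ℝ] E3) (t m + A z - c) := fun m z _ => by simp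
  have hconst := dispForce_sublattice_const (t := t) (A := A) (aff := fun _ : E3 => (0 : E3)) (a := (0 : Fin 2 → E3))
    (B := (0 : E3 →L[ℝ] E3)) (x₀ := c) haff0 0 zero_mem_Λ₀ hz
  have ht0 : t 0 + A 0 = t 0 := by rw [map_zero, add_zero]
  have hG : 𝐆[fun _ : E3 => (0 : E3)] (⟨t 0, t0_mem_sites⟩ : Sites₀ t A) = 𝐆[fun _ : E3 => (0 : E3)] (⟨t 0 + A z, hs⟩ : Sites₀ t A) := by
    have := hconst
    simp only [ht0] at this
    exact this.symm
  rw [hG, selfForce_zero_eq_refForce]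
  -- the reference force at the deep site
  have hsc : dist (t 0 + A z) c ≤ r := by linarith
  have h := norm_refForce_le_of_matched hA hI hX hsep hδ hε0 hε2 hε hXb hπ hinj hs hsc (by linarith) (by linarith) SR hSR
    (hequil _ (hπ _ hs hsc).1)
  refine h.trans ?_
  have h1 : r - 11 / 10 ≤ r - dist (t 0 + A z) c := by linarith
  have h2 : r - 11 / 10 - 2 * ε ≤ r - dist (t 0 + A z) c - 2 * ε := by linarith
  have h3 : 0 < r - 11 / 10 := by linarith
  have h4 : 0 < r - 11 / 10 - 2 * ε := by linarith
  gcongr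

/-- **The base case: relaxing the datum.**  If the self-force bound is below the relaxation threshold, the zero
approximant relaxes by a shift `ξ₀` of the sublattice `S₀` with `‖ξ₀‖ ≤ (4/κ)‖G[0](t 0)‖`; the field
`𝟙_{S₀} ξ₀` is affine-plus-shift with data `(![ξ₀, 0], 0)` (any base point) and has no self-force. [folklore] -/
theorem base_relaxation (hA : Adm₀ A) (hI : Inner₀ t A) (hκ0 : 0 < κ) (hκ1 : κ ≤ 1)
    (hκ : ∀ v : E3 → E3, (Function.support v).Finite → Function.support v ⊆ Sites₀ t A →
      κ * nnForm t A v ≤ ∑' p : Sites₀ t A, ⟪𝕃 v @ p, v p⟫)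
    (hG : ‖𝐆[fun _ : E3 => (0 : E3)] (⟨t 0, t0_mem_sites⟩ : Sites₀ t A)‖ ≤ κ ^ 2 / 10 ^ 11) (c₀ : E3) :
    ∃ ξ₀ : E3, ‖ξ₀‖ ≤ 4 / κ * ‖𝐆[fun _ : E3 => (0 : E3)] (⟨t 0, t0_mem_sites⟩ : Sites₀ t A)‖ ∧
      (∀ (m : Fin 2) (z : E3), z ∈ Λ₀ →
        (fun x : E3 => (0 : E3) + (if (∃ z ∈ Λ₀, x = t 0 + A z) then ξ₀ else 0)) (t m + A z) =
          (![(0 : E3) + ξ₀, 0] : Fin 2 → E3) m + (0 : E3 →L[ℝ] E3) (t m + A z - c₀)) ∧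
      ∀ p : Sites₀ t A, 𝐆[fun x : E3 => (0 : E3) + (if (∃ z ∈ Λ₀, x = t 0 + A z) then ξ₀ else 0)] p = 0 := by
  have haff0 : ∀ (m : Fin 2) (z : E3), z ∈ Λ₀ → (fun _ : E3 => (0 : E3)) (t m + A z) =
      (0 : Fin 2 → E3) m + (0 : E3 →L[ℝ] E3) (t m + A z - c₀) := fun m z _ => by simp
  have hB : ‖(0 : E3 →L[ℝ] E3)‖ ≤ κ / 10 ^ 10 := by rw [norm_zero]; positivity
  have ha : ‖(0 : Fin 2 → E3) 0 - (0 : Fin 2 → E3) 1‖ ≤ κ / 10 ^ 10 := by simp; positivity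
  obtain ⟨ξ, hξ, haff', hrel'⟩ := exists_relaxed_field hA hI hκ0 hκ1 hκ (aff := fun _ : E3 => (0 : E3)) (a := (0 : Fin 2 → E3))
    (B := (0 : E3 →L[ℝ] E3)) (x₀ := c₀) haff0 hB ha hG
  refine ⟨ξ, hξ, fun m z hz => ?_, hrel'⟩
  have h := haff' m z hz
  simp only [Pi.zero_apply, zero_add] at h ⊢
  exact h

end

end Summit.AtomisticToContinuum.Crystallization.Theorems.ExcessDecayLiouville

end
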